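import Mathlib.Algebra.Ring.GeomSum
import Mathlib.Logic.Equiv.Defs
import Mathlib.GroupTheory.Perm.Basic
import Mathlib.Data.Fintype.BigOperators
import Mathlib.Algebra.Order.BigOperators.Group.Finset
import Mathlib.Tactic.Linarith
import Mathlib.Tactic.Positivity
import Mathlib.Tactic.Ring

/-!
# Route «KPlusLogSqLaw», crux `TropicalB` (stmt-ValiantsHypothesis-19771) — INCIDENCE CODES in a large base: bounded digit vectors are free

HONEST FRAMING.  Helper toward the registered stubs `stub_tropThin` / `stub_tropFat` of `Cruxes/TropicalB/Lines/birth.lean` (crux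
`Summit.ValiantsHypothesis.ValiantsHypothesis.Theses.KPlusLogSqLaw.TropicalB`, item stmt-ValiantsHypothesis-19771, route KPlusLogSqLaw; cell
`pub-symmetroid`, seat val-sym-trop-p1 g25, 2026-08-29; `--supports … --as helper`).  Part 2a (pure arithmetic, Mathlib only) of the SINGLE-ORBIT /
TIGHT NORMAL FORM of the unsigned row: the genericity tool behind `…TropicalBGenericPerturbation`.  Nothing here is about `TropicalB` itself, and
nothing bears on `WeakLifting`, DoorA26 / DoorA34, `MatrixDescartes` (stmt-ValiantsHypothesis-18050) or VP ≠ VNP.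

A Leibniz term `q = (σ, λ)` of an `m × m` design with `K` classes uses the `m` incidences `(σ b, b, λ b)`; with an injective code
`code : Fin m → Fin m → Fin K → ℕ` its CODE SUM in base `B` is `η_B(q) = Σ_b B^{code(σ b, b, λ b)}` — a base-`B` number with `m` digits equal to `1`.

* `digits_eq_zero` — if `|c x| ≤ C`, `C + 2 ≤ B` and `Σ_{x<T} c x · B^x = 0` then `c x = 0` for all `x < T` (bounded digit vectors are free).
* `sum_pow_code_eq_sum_image`, `eq_of_image_code_eq` — the code sum is the sum over the code IMAGE, and the image determines the term.
* `eq_of_codeSum_eq` — `η_B` is injective on terms (`B ≥ 3`).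
* `eq_of_three_term_relation` — **if `α, β > 0`, `α + β + 3 ≤ B` and `α·η_B(q₃) + β·η_B(q₁) = (α+β)·η_B(q₂)` then `q₁ = q₂ = q₃`**: the relation a
  COLLINEAR triple of perturbed terms would satisfy has only trivial solutions.  This is what makes «no three present terms collinear» after the
  perturbation `v ↦ N·v + B^code` (part 2b).
[folklore: uniqueness of base-`B` expansions with digits bounded by `B − 2`]
-/

set_option linter.dupNamespace false
set_option autoImplicit false

namespace Summit.ValiantsHypothesis.ValiantsHypothesis.Theorems.KPlusLogSqLaw

open scoped BigOperators
open Finset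

namespace TightChain

/-- **Bounded digit vectors are free.**  If `|c x| ≤ C` for all `x`, `C + 2 ≤ B`, and `Σ_{x < T} c x · B^x = 0`, then `c x = 0` for every `x < T`.
[folklore] -/
theorem digits_eq_zero (B C : ℕ) (hB : C + 2 ≤ B) (c : ℕ → ℤ) (hc : ∀ x, |c x| ≤ C) :
    ∀ T : ℕ, (∑ x ∈ range T, c x * (B : ℤ) ^ x) = 0 → ∀ x, x < T → c x = 0 := by
  intro T
  induction T with
  | zero => intro _ x hx; exact absurd hx (Nat.not_lt_zero x)
  | succ T ih =>
    intro hsum x hx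
    rw [sum_range_succ] at hsum
    -- the top digit vanishes: `|c T| · B^T = |Σ_{x<T} c x B^x| ≤ C · (B^T − 1)/(B − 1) < B^T`
    have hB2 : (2 : ℤ) ≤ (B : ℤ) := by exact_mod_cast (le_trans (by omega) hB)
    have hB0 : (0 : ℤ) < (B : ℤ) := by linarith
    have hB1 : (1 : ℤ) ≤ (B : ℤ) - 1 := by linarith
    have hgeom : (∑ x ∈ range T, (B : ℤ) ^ x) * ((B : ℤ) - 1) = (B : ℤ) ^ T - 1 := geom_sum_mul _ _
    have hG0 : (0 : ℤ) ≤ ∑ x ∈ range T, (B : ℤ) ^ x := sum_nonneg fun i _ => by positivity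
    have habs : |∑ x ∈ range T, c x * (B : ℤ) ^ x| ≤ (C : ℤ) * ∑ x ∈ range T, (B : ℤ) ^ x := by
      calc |∑ x ∈ range T, c x * (B : ℤ) ^ x| ≤ ∑ x ∈ range T, |c x * (B : ℤ) ^ x| := abs_sum_le_sum_abs _ _
        _ ≤ ∑ x ∈ range T, (C : ℤ) * (B : ℤ) ^ x := by
            refine sum_le_sum fun i _ => ?_
            rw [abs_mul, abs_of_nonneg (by positivity : (0 : ℤ) ≤ (B : ℤ) ^ i)]
            exact mul_le_mul_of_nonneg_right (hc i) (by positivity)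
        _ = (C : ℤ) * ∑ x ∈ range T, (B : ℤ) ^ x := by rw [mul_sum]
    have hcT : c T = 0 := by
      by_contra hne
      have h1 : (1 : ℤ) ≤ |c T| := Int.one_le_abs hne
      have hBT : (0 : ℤ) < (B : ℤ) ^ T := by positivity
      have h2 : (B : ℤ) ^ T ≤ |c T * (B : ℤ) ^ T| := by
        rw [abs_mul, abs_of_nonneg hBT.le]; nlinarith
      have h3 : c T * (B : ℤ) ^ T = -(∑ x ∈ range T, c x * (B : ℤ) ^ x) := by linarith
      rw [h3, abs_neg] at h2
      -- `(B−1)·B^T ≤ (B−1)·C·G = C·(B^T − 1) < C·B^T ≤ (B−2)·B^T`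
      have h4 : ((B : ℤ) - 1) * (B : ℤ) ^ T ≤ (C : ℤ) * ((B : ℤ) ^ T - 1) := by
        have := mul_le_mul_of_nonneg_left (h2.trans habs) (by linarith : (0 : ℤ) ≤ (B : ℤ) - 1)
        rw [← hgeom]; linarith
      have hC : (C : ℤ) + 2 ≤ (B : ℤ) := by exact_mod_cast hB
      have hC0 : (0 : ℤ) ≤ (C : ℤ) := by positivity
      nlinarith
    rw [hcT, zero_mul, add_zero] at hsum
    rcases Nat.lt_succ_iff_lt_or_eq.mp hx with hlt | heq
    · exact ih hsum x hlt
    · rw [heq]; exact hcT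

variable {m K : ℕ}

/-- the code sum of a term is the sum of `B^x` over its code IMAGE (codes of distinct columns are distinct). [folklore] -/
theorem sum_pow_code_eq_sum_image (code : Fin m → Fin m → Fin K → ℕ)
    (hcode : ∀ a b l a' b' l', code a b l = code a' b' l' → a = a' ∧ b = b' ∧ l = l') (B : ℤ)
    (q : Equiv.Perm (Fin m) × (Fin m → Fin K)) :
    (∑ i, B ^ code (q.1 i) i (q.2 i)) = ∑ x ∈ univ.image (fun i => code (q.1 i) i (q.2 i)), B ^ x := by
  classical
  rw [sum_image]
  intro i _ i' _ h
  exact (hcode _ _ _ _ _ _ h).2.1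

/-- a term is determined by its code image. [folklore] -/
theorem eq_of_image_code_eq (code : Fin m → Fin m → Fin K → ℕ)
    (hcode : ∀ a b l a' b' l', code a b l = code a' b' l' → a = a' ∧ b = b' ∧ l = l')
    (q q' : Equiv.Perm (Fin m) × (Fin m → Fin K))
    (h : univ.image (fun i => code (q.1 i) i (q.2 i)) = univ.image (fun i => code (q'.1 i) i (q'.2 i))) : q = q' := by
  classical
  have key : ∀ i, q.1 i = q'.1 i ∧ q.2 i = q'.2 i := by
    intro i
    have hi : code (q.1 i) i (q.2 i) ∈ univ.image (fun i => code (q'.1 i) i (q'.2 i)) := by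
      rw [← h]; exact mem_image_of_mem _ (mem_univ i)
    obtain ⟨i', _, hi'⟩ := mem_image.mp hi
    obtain ⟨h1, h2, h3⟩ := hcode _ _ _ _ _ _ hi'.symm
    subst h2
    exact ⟨h1, h3⟩
  exact Prod.ext (Equiv.ext fun i => (key i).1) (funext fun i => (key i).2)

/-- membership indicator of the code image, as an integer. -/
private theorem indicator_bounds (S : Finset ℕ) (x : ℕ) : (0 : ℤ) ≤ (if x ∈ S then 1 else 0) ∧ (if x ∈ S then (1 : ℤ) else 0) ≤ 1 := by
  split_ifs <;> simp

/-- sum of `B^x` over a finite set of exponents below `T`, as a digit sum over `range T`. [folklore] -/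
theorem sum_pow_eq_sum_range_indicator (S : Finset ℕ) (T : ℕ) (hS : ∀ x ∈ S, x < T) (B : ℤ) :
    (∑ x ∈ S, B ^ x) = ∑ x ∈ range T, (if x ∈ S then (1 : ℤ) else 0) * B ^ x := by
  classical
  have hsub : S ⊆ range T := fun x hx => mem_range.mpr (hS x hx)
  rw [← sum_subset hsub (f := fun x => (if x ∈ S then (1 : ℤ) else 0) * B ^ x)]
  · exact sum_congr rfl fun x hx => by rw [if_pos hx, one_mul]
  · intro x _ hx; rw [if_neg hx, zero_mul]

/-- **The three-term relation has only trivial solutions.**  For terms `q₁, q₂, q₃`, positive integers `α, β` with `α + β + 3 ≤ B`, and an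
injective code with values below `T`: `α·η_B(q₃) + β·η_B(q₁) = (α+β)·η_B(q₂)` forces `q₁ = q₂` and `q₂ = q₃`. [folklore] -/
theorem eq_of_three_term_relation (code : Fin m → Fin m → Fin K → ℕ)
    (hcode : ∀ a b l a' b' l', code a b l = code a' b' l' → a = a' ∧ b = b' ∧ l = l') (T : ℕ) (hT : ∀ a b l, code a b l < T)
    (B : ℕ) (α β : ℤ) (hα : 0 < α) (hβ : 0 < β) (hB : α + β + 3 ≤ (B : ℤ))
    (q₁ q₂ q₃ : Equiv.Perm (Fin m) × (Fin m → Fin K))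
    (h : α * (∑ i, (B : ℤ) ^ code (q₃.1 i) i (q₃.2 i)) + β * (∑ i, (B : ℤ) ^ code (q₁.1 i) i (q₁.2 i)) =
      (α + β) * ∑ i, (B : ℤ) ^ code (q₂.1 i) i (q₂.2 i)) : q₁ = q₂ ∧ q₂ = q₃ := by
  classical
  set I₁ : Finset ℕ := univ.image (fun i => code (q₁.1 i) i (q₁.2 i)) with hI₁
  set I₂ : Finset ℕ := univ.image (fun i => code (q₂.1 i) i (q₂.2 i)) with hI₂
  set I₃ : Finset ℕ := univ.image (fun i => code (q₃.1 i) i (q₃.2 i)) with hI₃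
  have hIT : ∀ (q : Equiv.Perm (Fin m) × (Fin m → Fin K)), ∀ x ∈ univ.image (fun i => code (q.1 i) i (q.2 i)), x < T := by
    intro q x hx
    obtain ⟨i, _, rfl⟩ := mem_image.mp hx
    exact hT _ _ _
  rw [sum_pow_code_eq_sum_image code hcode, sum_pow_code_eq_sum_image code hcode, sum_pow_code_eq_sum_image code hcode,
    sum_pow_eq_sum_range_indicator _ T (hIT q₃), sum_pow_eq_sum_range_indicator _ T (hIT q₁),
    sum_pow_eq_sum_range_indicator _ T (hIT q₂)] at h
  -- the digit vector of the relation
  set c : ℕ → ℤ := fun x => α * (if x ∈ I₃ then 1 else 0) + β * (if x ∈ I₁ then 1 else 0) - (α + β) * (if x ∈ I₂ then 1 else 0) with hc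
  have hsum : (∑ x ∈ range T, c x * (B : ℤ) ^ x) = 0 := by
    have : (∑ x ∈ range T, c x * (B : ℤ) ^ x) = α * (∑ x ∈ range T, (if x ∈ I₃ then (1 : ℤ) else 0) * (B : ℤ) ^ x) +
        β * (∑ x ∈ range T, (if x ∈ I₁ then (1 : ℤ) else 0) * (B : ℤ) ^ x) -
        (α + β) * (∑ x ∈ range T, (if x ∈ I₂ then (1 : ℤ) else 0) * (B : ℤ) ^ x) := by
      rw [mul_sum, mul_sum, mul_sum, ← sum_add_distrib, ← sum_sub_distrib]
      exact sum_congr rfl fun x _ => by rw [hc]; ring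
    rw [this, h]; ring
  -- its digits are bounded by `α + β`
  set C : ℕ := (α + β).toNat with hC
  have hCeq : (C : ℤ) = α + β := by rw [hC]; exact Int.toNat_of_nonneg (by linarith)
  have hcb : ∀ x, |c x| ≤ C := by
    intro x
    rw [hCeq, abs_le]
    obtain ⟨a0, a1⟩ := indicator_bounds I₃ x
    obtain ⟨b0, b1⟩ := indicator_bounds I₁ x
    obtain ⟨c0, c1⟩ := indicator_bounds I₂ x
    constructor <;> nlinarith
  have hCB : C + 2 ≤ B := by
    have : (C : ℤ) + 2 ≤ (B : ℤ) := by linarith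
    exact_mod_cast this
  have hzero := digits_eq_zero B C hCB c hcb T hsum
  -- reading off the memberships
  have hmem : ∀ x, (x ∈ I₁ ↔ x ∈ I₂) ∧ (x ∈ I₃ ↔ x ∈ I₂) := by
    intro x
    by_cases hxT : x < T
    · have h0 := hzero x hxT
      simp only [hc] at h0
      by_cases h2 : x ∈ I₂ <;> by_cases h1 : x ∈ I₁ <;> by_cases h3 : x ∈ I₃ <;> simp only [h1, h2, h3, if_true, if_false] at h0 ⊢ <;>
        first | exact ⟨Iff.rfl, Iff.rfl⟩ | (exfalso; nlinarith) | simp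
    · refine ⟨⟨fun hx => absurd (hIT q₁ x hx) hxT, fun hx => absurd (hIT q₂ x hx) hxT⟩,
        ⟨fun hx => absurd (hIT q₃ x hx) hxT, fun hx => absurd (hIT q₂ x hx) hxT⟩⟩
  have h12 : I₁ = I₂ := Finset.ext fun x => (hmem x).1
  have h32 : I₃ = I₂ := Finset.ext fun x => (hmem x).2
  exact ⟨eq_of_image_code_eq code hcode q₁ q₂ h12, (eq_of_image_code_eq code hcode q₃ q₂ h32).symm⟩

/-- **Code sums are injective** (`B ≥ 3`): `η_B(q) = η_B(q')` forces `q = q'`. [folklore] -/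
theorem eq_of_codeSum_eq (code : Fin m → Fin m → Fin K → ℕ)
    (hcode : ∀ a b l a' b' l', code a b l = code a' b' l' → a = a' ∧ b = b' ∧ l = l') (T : ℕ) (hT : ∀ a b l, code a b l < T)
    (B : ℕ) (hB : 3 ≤ B) (q q' : Equiv.Perm (Fin m) × (Fin m → Fin K))
    (h : (∑ i, (B : ℤ) ^ code (q.1 i) i (q.2 i)) = ∑ i, (B : ℤ) ^ code (q'.1 i) i (q'.2 i)) : q = q' := by
  classical
  set I : Finset ℕ := univ.image (fun i => code (q.1 i) i (q.2 i)) with hI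
  set I' : Finset ℕ := univ.image (fun i => code (q'.1 i) i (q'.2 i)) with hI'
  have hIT : ∀ (q : Equiv.Perm (Fin m) × (Fin m → Fin K)), ∀ x ∈ univ.image (fun i => code (q.1 i) i (q.2 i)), x < T := by
    intro q x hx
    obtain ⟨i, _, rfl⟩ := mem_image.mp hx
    exact hT _ _ _
  rw [sum_pow_code_eq_sum_image code hcode, sum_pow_code_eq_sum_image code hcode,
    sum_pow_eq_sum_range_indicator _ T (hIT q), sum_pow_eq_sum_range_indicator _ T (hIT q')] at h
  set c : ℕ → ℤ := fun x => (if x ∈ I then 1 else 0) - (if x ∈ I' then 1 else 0) with hc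
  have hsum : (∑ x ∈ range T, c x * (B : ℤ) ^ x) = 0 := by
    have : (∑ x ∈ range T, c x * (B : ℤ) ^ x) = (∑ x ∈ range T, (if x ∈ I then (1 : ℤ) else 0) * (B : ℤ) ^ x) -
        ∑ x ∈ range T, (if x ∈ I' then (1 : ℤ) else 0) * (B : ℤ) ^ x := by
      rw [← sum_sub_distrib]
      exact sum_congr rfl fun x _ => by rw [hc]; ring
    rw [this, h]; ring
  have hcb : ∀ x, |c x| ≤ (1 : ℕ) := by
    intro x
    rw [Nat.cast_one, abs_le]
    obtain ⟨a0, a1⟩ := indicator_bounds I x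
    obtain ⟨b0, b1⟩ := indicator_bounds I' x
    constructor <;> linarith
  have hzero := digits_eq_zero B 1 (by omega) c hcb T hsum
  have hmem : ∀ x, x ∈ I ↔ x ∈ I' := by
    intro x
    by_cases hxT : x < T
    · have h0 := hzero x hxT
      simp only [hc] at h0
      by_cases h1 : x ∈ I <;> by_cases h2 : x ∈ I' <;> simp only [h1, h2, if_true, if_false] at h0 ⊢ <;> simp at h0 ⊢
    · exact ⟨fun hx => absurd (hIT q x hx) hxT, fun hx => absurd (hIT q' x hx) hxT⟩
  exact eq_of_image_code_eq code hcode q q' (Finset.ext hmem)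

end TightChain

end Summit.ValiantsHypothesis.ValiantsHypothesis.Theorems.KPlusLogSqLaw
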